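import Summits.Ventures.CertifiedManyBodySolver.Downfold.EmeryFermiFillingLa214Subs
import Summits.Ventures.CertifiedManyBodySolver.Downfold.EmeryBoxesLa214V122
import HarnessLib

/-!
# La₂CuO₄: the 3BE box of record `emeryBoxLa214` ⇒ a CERTIFIED window for the object-E Fermi-surface `t′/t`
# at the material filling — the three-band → one-band reduction error as an explicit, kernel-checked interval

Venture CertifiedManyBodySolver, cell `pub/hubbard-downfold` (stage S1, HUMAN RULINGS D-0096/D-0098: «three-band ↦
single-band reduction with the reduction error carried as an explicit inflation of the single-band box»), seat
hubbard-downfold-mod-4 (technique B = band level); namespace `Summit.Ventures.CertifiedManyBodySolver.Downfold.Emery`.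
Everything here is PROVED; every numerical fact is decided by the kernel (`decide +kernel` on the checkers of
`EmeryFermiFillingCount` / `EmeryFermiSurfaceRatioWindow` / `EmeryFermiFillingGrid24`; ≈ 3 s per sub-box).

THE STATEMENT (`emeryBoxLa214_fsRatio_window`). For EVERY parameter vector of the typed three-band box of record
`emeryBoxLa214` (`EmeryBoxesCuprates`: Δ_pd ∈ [1.7, 4.0], t_pd ∈ [1.29, 1.52], t_pp ∈ [0.46, 0.66], t_pp′ ∈ [0.12, 0.15] eV;
box #18 `router/BOXES/La2CuO4-family.md` «THREE-BAND (3BE) COMPANION BOX») and EVERY Fermi energy `ε` at which the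
σ-model antibonding band holds the material's electrons — per-spin filling `abFilling(ε) ∈ [0.495, 0.505]`, i.e. the
one-band density row `n ∈ [0.99, 1.01]` of column M13 (x = 0) — the EXACT `t–t′` shape of the three-band Fermi surface
(`EmeryFermiSurfaceShape`: every constant-energy contour of the σ model IS a `t–t′` contour) has

  `t′/t = fsRatio(ε) ∈ [-0.2955, -0.1653]`   (ε itself is pinned to `[1.14, 2.62]` eV above ε_d).

READING (the cell's INFL-3to1 language; numbers, not adjectives). Object E of record for La₂CuO₄ carries
`t′/t ∈ [−0.30, −0.20]` (one-band Wannier / Fermi-surface fits ⊕ FLOOR, `BoxesLa214*`). The three-band route covers it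
from below (−0.296 vs −0.30) and EXCEEDS it above: the high-Δ_pd / low-t_pp end of the 3BE box maps to a flatter Fermi
surface, down to |t′/t| = 0.165. `emeryBoxLa214_weakCorner_fsRatio` makes the cut explicit: on the sub-box
Δ_pd ∈ [3.5, 4.0] × t_pd ∈ [1.40, 1.52] × t_pp ∈ [0.46, 0.50] × t_pp′ ∈ [0.12, 0.13] the window is
[-0.197, -0.1651] ⊂ (−0.20, 0): THAT PART OF THE 3BE BOX IS INCONSISTENT WITH THE OBJECT-E ROW OF RECORD
(`emeryBoxLa214_weakCorner_not_objectE`), while the low-Δ_pd / high-t_pp corner (Δ_pd ∈ [1.7, 2.2] × t_pd ∈ [1.29, 1.40] ×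
t_pp ∈ [0.60, 0.66] × t_pp′ ∈ [0.14, 0.15]) maps INSIDE it, to [-0.2962, -0.2482] (`emeryBoxLa214_strongCorner_fsRatio`).
So: INFL-3to1-B(t′/t of object E, La₂CuO₄, FS level) = the E row would have to read [−0.30, −0.165] to contain every
σ-model of the 3BE companion box; conversely the E row of record locates the material in the Δ_pd ≲ 3.4 ∪ t_pp ≳ 0.5 part
of the 3BE box. No fit, no k-mesh, no energy window: measure theory + interval arithmetic + the exact contour theorem.

Sub-box certificates (Δ_pd × t_pd split 8 × 2; t_pp, t_pp′ full; K = 24 grid, 16 energy pieces; counts out of 576):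
| Δ_pd | t_pd | ε_F bracket (eV) | outer @e₁ | inner @e₂ | t′/t window |
|---|---|---|---|---|---|
| [1.7, 1.988] | [1.29, 1.405] | [1.6, 2.4] | 281/576 | 293/576 | [-0.2955, -0.2129] |
| [1.7, 1.988] | [1.405, 1.52] | [1.8, 2.62] | 281/576 | 291/576 | [-0.2859, -0.2042] |
| [1.988, 2.275] | [1.29, 1.405] | [1.52, 2.28] | 281/576 | 291/576 | [-0.2858, -0.2063] |
| [1.988, 2.275] | [1.405, 1.52] | [1.72, 2.52] | 285/576 | 295/576 | [-0.2769, -0.198] |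
| [2.275, 2.562] | [1.29, 1.405] | [1.44, 2.18] | 283/576 | 293/576 | [-0.2765, -0.1997] |
| [2.275, 2.562] | [1.405, 1.52] | [1.64, 2.4] | 285/576 | 293/576 | [-0.2682, -0.1922] |
| [2.562, 2.85] | [1.29, 1.405] | [1.38, 2.08] | 285/576 | 295/576 | [-0.2673, -0.1934] |
| [2.562, 2.85] | [1.405, 1.52] | [1.56, 2.3] | 285/576 | 295/576 | [-0.2598, -0.1864] |
| [2.85, 3.138] | [1.29, 1.405] | [1.32, 1.98] | 285/576 | 295/576 | [-0.2589, -0.1874] |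
| [2.85, 3.138] | [1.405, 1.52] | [1.5, 2.2] | 285/576 | 295/576 | [-0.2516, -0.1809] |
| [3.138, 3.425] | [1.29, 1.405] | [1.26, 1.88] | 285/576 | 291/576 | [-0.2512, -0.1816] |
| [3.138, 3.425] | [1.405, 1.52] | [1.42, 2.1] | 281/576 | 291/576 | [-0.2438, -0.1756] |
| [3.425, 3.712] | [1.29, 1.405] | [1.2, 1.8] | 285/576 | 291/576 | [-0.2438, -0.1759] |
| [3.425, 3.712] | [1.405, 1.52] | [1.36, 2.02] | 279/576 | 295/576 | [-0.2362, -0.1703] |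
| [3.712, 4] | [1.29, 1.405] | [1.14, 1.72] | 283/576 | 291/576 | [-0.2366, -0.1704] |
| [3.712, 4] | [1.405, 1.52] | [1.3, 1.94] | 279/576 | 295/576 | [-0.2293, -0.1653] |

WHAT THIS IS NOT: not a statement that La₂CuO₄'s parameters ARE in the box (the 3BE box is SCREENING-GRADE literature/DFT
provenance; this file certifies the REDUCTION STEP only); not the interaction (`U`) reduction; `t′/t` here is the
Fermi-surface SHAPE ratio of the σ three-band model (object E, `t″` folded), not the whole-band technique-B fit (object M);
the axial Cu-4s channel of [PavariniEtAl2001] is outside the σ model (for La the σ sets of record reproduce the one-band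
t′ without it, router/INFLATION-RULES-3to1-B.md §B.5); no phase sentence. Sources: [HybertsenSchluterChristensen1989, Eq. (1)];
[AndersenEtAl1995, §6]; [PavariniEtAl2001, Eq. (1)].
-/

noncomputable section

namespace Summit.Ventures.CertifiedManyBodySolver.Downfold.Emery

open Real Set
open Summit.Ventures.CertifiedManyBodySolver.Downfold

/-- Splitting a closed interval at any point. [folklore] -/
theorem mem_Icc_split {x a b : ℝ} (h : x ∈ Set.Icc a b) (m : ℝ) : x ∈ Set.Icc a m ∨ x ∈ Set.Icc m b := by
  rcases le_or_gt x m with hx | hx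
  · exact Or.inl ⟨h.1, hx⟩
  · exact Or.inr ⟨hx.le, h.2⟩

/-! ## The whole box, the typed word, and the two corner cuts -/

/-- **La₂CuO₄ 3BE box ⇒ object-E `t′/t` window (raw coordinates).** For Δ_pd ∈ [1.7, 4.0], t_pd ∈ [1.29, 1.52],
t_pp ∈ [0.46, 0.66], t_pp′ ∈ [0.12, 0.15] and every Fermi energy with per-spin filling in [0.495, 0.505]:
`t′/t ∈ [-0.2955, -0.1653]`. [folklore] -/
theorem la214Box_fsRatio_window {Δ tpd tpp c ε : ℝ} (hΔ : Δ ∈ Set.Icc (17 / 10 : ℝ) (4 : ℝ))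
    (ha : tpd ∈ Set.Icc (129 / 100 : ℝ) (38 / 25 : ℝ)) (hb : tpp ∈ Set.Icc (23 / 50 : ℝ) (33 / 50 : ℝ))
    (hc : c ∈ Set.Icc (3 / 25 : ℝ) (3 / 20 : ℝ))
    (hν : abFilling Δ tpd tpp c ε ∈ Set.Icc (99 / 200 : ℝ) (101 / 200)) :
    fsRatio Δ tpd tpp c ε ∈ Set.Icc (-(591 / 2000 : ℝ)) (-(1653 / 10000 : ℝ)) := by
  have hΔ' := hΔ
  rcases mem_Icc_split hΔ' (57 / 20 : ℝ) with hΔ' | hΔ'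
  · rcases mem_Icc_split hΔ' (91 / 40 : ℝ) with hΔ' | hΔ'
    · rcases mem_Icc_split hΔ' (159 / 80 : ℝ) with hΔ' | hΔ'
      · rcases mem_Icc_split ha (281 / 200 : ℝ) with ha' | ha'
        · have h := (la214Sub_0_0 hΔ' ha' hb hc hν).2
          exact ⟨le_trans (by norm_num) h.1, h.2.trans (by norm_num)⟩
        · have h := (la214Sub_0_1 hΔ' ha' hb hc hν).2
          exact ⟨le_trans (by norm_num) h.1, h.2.trans (by norm_num)⟩
      · rcases mem_Icc_split ha (281 / 200 : ℝ) with ha' | ha'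
        · have h := (la214Sub_1_0 hΔ' ha' hb hc hν).2
          exact ⟨le_trans (by norm_num) h.1, h.2.trans (by norm_num)⟩
        · have h := (la214Sub_1_1 hΔ' ha' hb hc hν).2
          exact ⟨le_trans (by norm_num) h.1, h.2.trans (by norm_num)⟩
    · rcases mem_Icc_split hΔ' (41 / 16 : ℝ) with hΔ' | hΔ'
      · rcases mem_Icc_split ha (281 / 200 : ℝ) with ha' | ha'
        · have h := (la214Sub_2_0 hΔ' ha' hb hc hν).2
          exact ⟨le_trans (by norm_num) h.1, h.2.trans (by norm_num)⟩
        · have h := (la214Sub_2_1 hΔ' ha' hb hc hν).2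
          exact ⟨le_trans (by norm_num) h.1, h.2.trans (by norm_num)⟩
      · rcases mem_Icc_split ha (281 / 200 : ℝ) with ha' | ha'
        · have h := (la214Sub_3_0 hΔ' ha' hb hc hν).2
          exact ⟨le_trans (by norm_num) h.1, h.2.trans (by norm_num)⟩
        · have h := (la214Sub_3_1 hΔ' ha' hb hc hν).2
          exact ⟨le_trans (by norm_num) h.1, h.2.trans (by norm_num)⟩
  · rcases mem_Icc_split hΔ' (137 / 40 : ℝ) with hΔ' | hΔ'
    · rcases mem_Icc_split hΔ' (251 / 80 : ℝ) with hΔ' | hΔ'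
      · rcases mem_Icc_split ha (281 / 200 : ℝ) with ha' | ha'
        · have h := (la214Sub_4_0 hΔ' ha' hb hc hν).2
          exact ⟨le_trans (by norm_num) h.1, h.2.trans (by norm_num)⟩
        · have h := (la214Sub_4_1 hΔ' ha' hb hc hν).2
          exact ⟨le_trans (by norm_num) h.1, h.2.trans (by norm_num)⟩
      · rcases mem_Icc_split ha (281 / 200 : ℝ) with ha' | ha'
        · have h := (la214Sub_5_0 hΔ' ha' hb hc hν).2
          exact ⟨le_trans (by norm_num) h.1, h.2.trans (by norm_num)⟩
        · have h := (la214Sub_5_1 hΔ' ha' hb hc hν).2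
          exact ⟨le_trans (by norm_num) h.1, h.2.trans (by norm_num)⟩
    · rcases mem_Icc_split hΔ' (297 / 80 : ℝ) with hΔ' | hΔ'
      · rcases mem_Icc_split ha (281 / 200 : ℝ) with ha' | ha'
        · have h := (la214Sub_6_0 hΔ' ha' hb hc hν).2
          exact ⟨le_trans (by norm_num) h.1, h.2.trans (by norm_num)⟩
        · have h := (la214Sub_6_1 hΔ' ha' hb hc hν).2
          exact ⟨le_trans (by norm_num) h.1, h.2.trans (by norm_num)⟩
      · rcases mem_Icc_split ha (281 / 200 : ℝ) with ha' | ha'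
        · have h := (la214Sub_7_0 hΔ' ha' hb hc hν).2
          exact ⟨le_trans (by norm_num) h.1, h.2.trans (by norm_num)⟩
        · have h := (la214Sub_7_1 hΔ' ha' hb hc hν).2
          exact ⟨le_trans (by norm_num) h.1, h.2.trans (by norm_num)⟩

/-- **THE WORD ON THE TYPED BOX OF RECORD.** On `emeryBoxLa214v122` (La₂CuO₄, box #18 §OF-RECORD v1.22, column M13; its
one-body rows Δ_pd, t_pd, t_pp, t_pp′ are those of `emeryBoxLa214`): at every parameter vector and every Fermi energy whose
antibonding-band filling is the M13 density row (`n/2 ∈ [0.495, 0.505]`), the exact Fermi-surface `t′/t` of the σ three-band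
model lies in `[-0.2955, -0.1653]`. [cite: HybertsenSchluterChristensen1989, Eq. (1) (three-band d–p model)] -/
theorem emeryBoxLa214v122_fsRatio_window :
    HoldsOn (fun p : EmeryCoord → ℝ => ∀ ε : ℝ,
      abFilling (p .DeltaPd) (p .tpd) (p .tpp) (p .tppP) ε ∈ Set.Icc (99 / 200 : ℝ) (101 / 200) →
      fsRatio (p .DeltaPd) (p .tpd) (p .tpp) (p .tppP) ε ∈ Set.Icc (-(591 / 2000 : ℝ)) (-(1653 / 10000 : ℝ))) emeryBoxLa214v122 := by
  intro p hp ε hν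
  obtain ⟨h1, h2, h3, h4, h5, h6, h7, h8, -⟩ := (emeryBoxLa214v122_mem_iff p).1 hp
  push_cast at h1 h2 h3 h4 h5 h6 h7 h8
  exact la214Box_fsRatio_window ⟨h1, h2⟩ ⟨h3, h4⟩ ⟨h5, h6⟩ ⟨h7, h8⟩ hν

/-- The same word on the older typed companion `emeryBoxLa214` (`EmeryBoxesCuprates`; ⊆ the v1.22 edition). [folklore] -/
theorem emeryBoxLa214_fsRatio_window :
    HoldsOn (fun p : EmeryCoord → ℝ => ∀ ε : ℝ,
      abFilling (p .DeltaPd) (p .tpd) (p .tpp) (p .tppP) ε ∈ Set.Icc (99 / 200 : ℝ) (101 / 200) →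
      fsRatio (p .DeltaPd) (p .tpd) (p .tpp) (p .tppP) ε ∈ Set.Icc (-(591 / 2000 : ℝ)) (-(1653 / 10000 : ℝ))) emeryBoxLa214 :=
  holdsOn_emeryBoxLa214_of_v122 emeryBoxLa214v122_fsRatio_window

/-- **The Fermi-energy bracket on the typed box of record**: at the M13 filling the σ-model Fermi energy of any member of
`emeryBoxLa214v122` lies in `[1.14, 2.62]` (units of the box, eV above ε_d). [folklore] -/
theorem emeryBoxLa214v122_fermiEnergy_bracket :
    HoldsOn (fun p : EmeryCoord → ℝ => ∀ ε : ℝ,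
      abFilling (p .DeltaPd) (p .tpd) (p .tpp) (p .tppP) ε ∈ Set.Icc (99 / 200 : ℝ) (101 / 200) →
      ε ∈ Set.Icc (57 / 50 : ℝ) (131 / 50 : ℝ)) emeryBoxLa214v122 := by
  intro p hp ε hν
  obtain ⟨h1, h2, h3, h4, h5, h6, h7, h8, -⟩ := (emeryBoxLa214v122_mem_iff p).1 hp
  push_cast at h1 h2 h3 h4 h5 h6 h7 h8
  have hΔ : p .DeltaPd ∈ Set.Icc (17 / 10 : ℝ) (4 : ℝ) := ⟨h1, h2⟩
  have ha : p .tpd ∈ Set.Icc (129 / 100 : ℝ) (38 / 25 : ℝ) := ⟨h3, h4⟩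
  have hb : p .tpp ∈ Set.Icc (23 / 50 : ℝ) (33 / 50 : ℝ) := ⟨h5, h6⟩
  have hc : p .tppP ∈ Set.Icc (3 / 25 : ℝ) (3 / 20 : ℝ) := ⟨h7, h8⟩
  have hΔ' := hΔ
  rcases mem_Icc_split hΔ' (57 / 20 : ℝ) with hΔ' | hΔ'
  · rcases mem_Icc_split hΔ' (91 / 40 : ℝ) with hΔ' | hΔ'
    · rcases mem_Icc_split hΔ' (159 / 80 : ℝ) with hΔ' | hΔ'
      · rcases mem_Icc_split ha (281 / 200 : ℝ) with ha' | ha'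
        · have h := (la214Sub_0_0 hΔ' ha' hb hc hν).1
          exact ⟨le_trans (by norm_num) h.1, h.2.trans (by norm_num)⟩
        · have h := (la214Sub_0_1 hΔ' ha' hb hc hν).1
          exact ⟨le_trans (by norm_num) h.1, h.2.trans (by norm_num)⟩
      · rcases mem_Icc_split ha (281 / 200 : ℝ) with ha' | ha'
        · have h := (la214Sub_1_0 hΔ' ha' hb hc hν).1
          exact ⟨le_trans (by norm_num) h.1, h.2.trans (by norm_num)⟩
        · have h := (la214Sub_1_1 hΔ' ha' hb hc hν).1
          exact ⟨le_trans (by norm_num) h.1, h.2.trans (by norm_num)⟩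
    · rcases mem_Icc_split hΔ' (41 / 16 : ℝ) with hΔ' | hΔ'
      · rcases mem_Icc_split ha (281 / 200 : ℝ) with ha' | ha'
        · have h := (la214Sub_2_0 hΔ' ha' hb hc hν).1
          exact ⟨le_trans (by norm_num) h.1, h.2.trans (by norm_num)⟩
        · have h := (la214Sub_2_1 hΔ' ha' hb hc hν).1
          exact ⟨le_trans (by norm_num) h.1, h.2.trans (by norm_num)⟩
      · rcases mem_Icc_split ha (281 / 200 : ℝ) with ha' | ha'
        · have h := (la214Sub_3_0 hΔ' ha' hb hc hν).1
          exact ⟨le_trans (by norm_num) h.1, h.2.trans (by norm_num)⟩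
        · have h := (la214Sub_3_1 hΔ' ha' hb hc hν).1
          exact ⟨le_trans (by norm_num) h.1, h.2.trans (by norm_num)⟩
  · rcases mem_Icc_split hΔ' (137 / 40 : ℝ) with hΔ' | hΔ'
    · rcases mem_Icc_split hΔ' (251 / 80 : ℝ) with hΔ' | hΔ'
      · rcases mem_Icc_split ha (281 / 200 : ℝ) with ha' | ha'
        · have h := (la214Sub_4_0 hΔ' ha' hb hc hν).1
          exact ⟨le_trans (by norm_num) h.1, h.2.trans (by norm_num)⟩
        · have h := (la214Sub_4_1 hΔ' ha' hb hc hν).1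
          exact ⟨le_trans (by norm_num) h.1, h.2.trans (by norm_num)⟩
      · rcases mem_Icc_split ha (281 / 200 : ℝ) with ha' | ha'
        · have h := (la214Sub_5_0 hΔ' ha' hb hc hν).1
          exact ⟨le_trans (by norm_num) h.1, h.2.trans (by norm_num)⟩
        · have h := (la214Sub_5_1 hΔ' ha' hb hc hν).1
          exact ⟨le_trans (by norm_num) h.1, h.2.trans (by norm_num)⟩
    · rcases mem_Icc_split hΔ' (297 / 80 : ℝ) with hΔ' | hΔ'
      · rcases mem_Icc_split ha (281 / 200 : ℝ) with ha' | ha'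
        · have h := (la214Sub_6_0 hΔ' ha' hb hc hν).1
          exact ⟨le_trans (by norm_num) h.1, h.2.trans (by norm_num)⟩
        · have h := (la214Sub_6_1 hΔ' ha' hb hc hν).1
          exact ⟨le_trans (by norm_num) h.1, h.2.trans (by norm_num)⟩
      · rcases mem_Icc_split ha (281 / 200 : ℝ) with ha' | ha'
        · have h := (la214Sub_7_0 hΔ' ha' hb hc hν).1
          exact ⟨le_trans (by norm_num) h.1, h.2.trans (by norm_num)⟩
        · have h := (la214Sub_7_1 hΔ' ha' hb hc hν).1
          exact ⟨le_trans (by norm_num) h.1, h.2.trans (by norm_num)⟩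

/-- **THE WEAK-t′ CORNER CUT.** On the sub-box Δ_pd ∈ [3.5, 4.0] × t_pd ∈ [1.40, 1.52] × t_pp ∈ [0.46, 0.50] × t_pp′ ∈ [0.12, 0.13] of `emeryBoxLa214`, at the M13 filling the Fermi-surface `t′/t` lies in [-0.197, -0.1651] — strictly above −1/5. [folklore] -/
theorem emeryBoxLa214_weakCorner_fsRatio {Δ tpd tpp c ε : ℝ} (hΔ : Δ ∈ Set.Icc (7 / 2 : ℝ) (4 : ℝ))
    (ha : tpd ∈ Set.Icc (7 / 5 : ℝ) (38 / 25 : ℝ)) (hb : tpp ∈ Set.Icc (23 / 50 : ℝ) (1 / 2 : ℝ))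
    (hc : c ∈ Set.Icc (3 / 25 : ℝ) (13 / 100 : ℝ))
    (hν : abFilling Δ tpd tpp c ε ∈ Set.Icc (99 / 200 : ℝ) (101 / 200)) :
    ε ∈ Set.Icc (32 / 25 : ℝ) (49 / 25 : ℝ) ∧ fsRatio Δ tpd tpp c ε ∈ Set.Icc (-(197 / 1000 : ℝ)) (-(1651 / 10000 : ℝ)) := by
  have h := fsRatio_window_of_checks (by norm_num) gridEncl24
    (Δ₁ := ((7 : ℚ) / 2)) (Δ₂ := (4 : ℚ)) (a₁ := ((7 : ℚ) / 5)) (a₂ := ((38 : ℚ) / 25)) (b₁ := ((23 : ℚ) / 50)) (b₂ := ((1 : ℚ) / 2))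
    (c₁ := ((3 : ℚ) / 25)) (c₂ := ((13 : ℚ) / 100)) (e₁ := ((32 : ℚ) / 25)) (e₂ := ((49 : ℚ) / 25))
    (Ahi := ((557568 : ℚ) / 15625)) (Dlo := ((267919 : ℚ) / 31250)) (Nlo := ((39353 : ℚ) / 15625))
    (Alo := ((3651921 : ℚ) / 62500)) (Dhi := ((193253 : ℚ) / 15625)) (Nhi := ((422541 : ℚ) / 125000))
    (lo := ((-197 : ℚ) / 1000)) (hi := ((-1651 : ℚ) / 10000)) (ν₁ := (99 : ℚ) / 200) (ν₂ := (101 : ℚ) / 200) (m := 16)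
    (by decide +kernel) (by decide +kernel) (by decide +kernel) (by decide +kernel) (by decide +kernel)
    (Δ := Δ) (tpd := tpd) (tpp := tpp) (c := c) (ε := ε)
    (by simpa using hΔ) (by simpa using ha) (by simpa using hb) (by simpa using hc) (by simpa using hν)
  norm_num at h ⊢
  exact h

/-- **… hence that corner of the 3BE box is INCONSISTENT with the object-E row of record `t′/t ∈ [−0.30, −0.20]`**
(`BoxesLa214*`: `la214E_M13v19_tp = [−3/10, −1/5]`): a certified mutual-consistency cut between the two boxes of record
(either the material's σ-parameters avoid this corner or the E row is violated). [folklore] -/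
theorem emeryBoxLa214_weakCorner_not_objectE {Δ tpd tpp c ε : ℝ} (hΔ : Δ ∈ Set.Icc (7 / 2 : ℝ) (4 : ℝ))
    (ha : tpd ∈ Set.Icc (7 / 5 : ℝ) (38 / 25 : ℝ)) (hb : tpp ∈ Set.Icc (23 / 50 : ℝ) (1 / 2 : ℝ))
    (hc : c ∈ Set.Icc (3 / 25 : ℝ) (13 / 100 : ℝ))
    (hν : abFilling Δ tpd tpp c ε ∈ Set.Icc (99 / 200 : ℝ) (101 / 200)) :
    fsRatio Δ tpd tpp c ε ∉ Set.Icc (-(3 / 10 : ℝ)) (-(1 / 5 : ℝ)) := by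
  intro hmem
  have h := (emeryBoxLa214_weakCorner_fsRatio hΔ ha hb hc hν).2
  have : (-(1 / 5 : ℝ)) < (-(197 / 1000 : ℝ)) := by norm_num
  linarith [h.1, hmem.2]

/-- **THE STRONG-t′ CORNER.** On the sub-box Δ_pd ∈ [1.7, 2.2] × t_pd ∈ [1.29, 1.40] × t_pp ∈ [0.60, 0.66] × t_pp′ ∈ [0.14, 0.15] of `emeryBoxLa214`, at the M13 filling the Fermi-surface `t′/t` lies in [-0.2962, -0.2482] ⊂ [−0.30, −0.20] — inside the object-E row of record. [folklore] -/
theorem emeryBoxLa214_strongCorner_fsRatio {Δ tpd tpp c ε : ℝ} (hΔ : Δ ∈ Set.Icc (17 / 10 : ℝ) (11 / 5 : ℝ))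
    (ha : tpd ∈ Set.Icc (129 / 100 : ℝ) (7 / 5 : ℝ)) (hb : tpp ∈ Set.Icc (3 / 5 : ℝ) (33 / 50 : ℝ))
    (hc : c ∈ Set.Icc (7 / 50 : ℝ) (3 / 20 : ℝ))
    (hν : abFilling Δ tpd tpp c ε ∈ Set.Icc (99 / 200 : ℝ) (101 / 200)) :
    ε ∈ Set.Icc (77 / 50 : ℝ) (12 / 5 : ℝ) ∧ fsRatio Δ tpd tpp c ε ∈ Set.Icc (-(1481 / 5000 : ℝ)) (-(1241 / 5000 : ℝ)) := by
  have h := fsRatio_window_of_checks (by norm_num) gridEncl24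
    (Δ₁ := ((17 : ℚ) / 10)) (Δ₂ := ((11 : ℚ) / 5)) (a₁ := ((129 : ℚ) / 100)) (a₂ := ((7 : ℚ) / 5)) (b₁ := ((3 : ℚ) / 5)) (b₂ := ((33 : ℚ) / 50))
    (c₁ := ((7 : ℚ) / 50)) (c₂ := ((3 : ℚ) / 20)) (e₁ := ((77 : ℚ) / 50)) (e₂ := ((12 : ℚ) / 5))
    (Ahi := ((2692613 : ℚ) / 125000)) (Dlo := ((1160811 : ℚ) / 250000)) (Nlo := ((371961 : ℚ) / 125000))
    (Alo := ((5043 : ℚ) / 125)) (Dhi := ((4669 : ℚ) / 625)) (Nhi := ((26163 : ℚ) / 6250))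
    (lo := ((-1481 : ℚ) / 5000)) (hi := ((-1241 : ℚ) / 5000)) (ν₁ := (99 : ℚ) / 200) (ν₂ := (101 : ℚ) / 200) (m := 16)
    (by decide +kernel) (by decide +kernel) (by decide +kernel) (by decide +kernel) (by decide +kernel)
    (Δ := Δ) (tpd := tpd) (tpp := tpp) (c := c) (ε := ε)
    (by simpa using hΔ) (by simpa using ha) (by simpa using hb) (by simpa using hc) (by simpa using hν)
  norm_num at h ⊢
  exact h

end Summit.Ventures.CertifiedManyBodySolver.Downfold.Emery
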